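import Mathlib
import Summits.NavierStokesRegularity.NavierStokesRegularity.Theorems.EulerZoomLiouvillePowerGaugeEulerLiouvilleDSSEndpointLocalEnergyEqualityTools
import Summits.NavierStokesRegularity.NavierStokesRegularity.Theorems.EulerZoomLiouvillePowerGaugeEulerLiouvilleDSSEndpointEnergyConst
import Summits.NavierStokesRegularity.NavierStokesRegularity.Theorems.EulerZoomLiouvillePowerGaugeEulerLiouvilleWindowFlux
import Summits.NavierStokesRegularity.NavierStokesRegularity.Theorems.EulerZoomLiouvillePowerGaugeEulerLiouvilleFluxTools
import Literature.Analysis.FluidPDE.VeryWeakToDistributional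
import Literature.Analysis.FluidPDE.EulerReynoldsLadderGluingIBP
import HarnessLib

/-!
# Rung C2 of the crux `EulerZoomLiouville.PowerGaugeEulerLiouville` at the endpoint `ρ = 1/2`:
# constant energy ⇒ LOCAL ENERGY EQUALITY; DSS endpoint members are locally energy-conservative

Route №10 `EulerZoomLiouville` (NavierStokesRegularity), crux E = stmt-NavierStokesRegularity-19832,
tenure rung C2 (`Sig.rungC2_dss`) at the energy-conserving endpoint `ρ = 1/2`.  The class carries the local
energy INEQUALITY `∂_t|u|² + div((|u|²+2p)u) ≤ 0`; critic-2's K3 asks for levers that use more than it.  At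
the endpoint the total energy of a member is finite and a.e. non-increasing; when it is a.e. CONSTANT the
inequality has no room left and becomes an EQUALITY:

* (tools in `…DSSEndpointLocalEnergyEqualityTools`: the class functional
  `L(ψ) = ∫∫ (|u|² ∂_tψ + (|u|²+2p)⟪u,∇ψ⟫)` as one integral, `L ≥ 0` on nonnegative tests, and the
  dominated-convergence lemma `∫ θ|u|²σ_k → E₀∫θ = 0`);
* `localEnergyEquality_of_energy_ae_const_half` — **an endpoint member whose total energy is a.e.
  constant satisfies `L(φ) = 0` for every nonnegative test `φ`**: `0 ≤ L(M χ⊗σ_k − φ)` for a time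
  cut-off `χ = 1` on the time-support of `φ` and the radial cut-offs `σ_k ↑ 1`, while
  `L(χ⊗σ_k) = ∫ χ'(t) ∫|u(t)|²σ_k + ∫ χ ∫(|u|²+2p)⟪u,∇σ_k⟫ → E₀ ∫χ' + 0 = 0` (finite energy; the lead's
  window-flux integrability `windowFlux_integrableOn_of_gauge`, `2/5 < 1/2`);
* `dss_half_localEnergyEquality` — **every DISCRETELY self-similar member at `ρ = 1/2` satisfies the local
  energy EQUALITY** (`dss_half_energy_ae_const`): the DSS analogue of the lead's endpoint flux identity
  for exactly self-similar members (`selfSimilar_endpoint_flux_identity`), obtained without any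
  velocity-testing of the Euler identity.

WHAT THIS IS NOT: not NS, not E, not rung C2 — structure of endpoint members, `--supports` stmt-19832.
-/

noncomputable section

-- flat `Theorems/<Route><Decl>…` files of one crux share the namespace of the crux (tree convention)
set_option linter.dupNamespace false

open MeasureTheory Set Filter Topology Metric Function TopologicalSpace
open scoped ENNReal NNReal InnerProductSpace RealInnerProductSpace

namespace Summit.NavierStokesRegularity.NavierStokesRegularity.Theorems.PowerGaugeEulerLiouville

open Literature.Analysis Literature.Analysis.FunctionSpaces Literature.Analysis.FluidPDE

section Equality

variable {u : ℝ → EuclideanSpace ℝ (Fin 3) → EuclideanSpace ℝ (Fin 3)}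
  {p : ℝ → EuclideanSpace ℝ (Fin 3) → ℝ}
  {H : ℝ → EuclideanSpace ℝ (Fin 3) → EuclideanSpace ℝ (Fin 3) →L[ℝ] EuclideanSpace ℝ (Fin 3)}
  {c : ℝ≥0}

/-- **Constant energy ⇒ local energy EQUALITY at the endpoint.**  Let `(u, p, H, c)` satisfy the three
hypotheses of the crux at `ρ = 1/2`, and let the total energy be a.e. constant: `∫ |u(τ)|² = E₀` for a.e.
`τ < 0`.  Then the local energy inequality of the class is an equality: for every nonnegative space–time
test `φ` on the slab, `∫∫ (|u|² ∂_tφ + (|u|² + 2p)⟪u, ∇φ⟫) = 0`. [folklore] -/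
theorem localEnergyEquality_of_energy_ae_const_half
    (hsw : IsSuitableWeakSolutionOn (slab (EuclideanSpace ℝ (Fin 3)) (Iio 0) isOpen_Iio) 0 0 u p)
    (hH : HasWeakSpatialGradientOn (slab (EuclideanSpace ℝ (Fin 3)) (Iio 0) isOpen_Iio) u H)
    (hgauge : ∀ a : ℝ, 0 < a →
      ENNReal.ofReal (a ^ (2 * (1 / 2 : ℝ))) * cknA a (0 : ℝ × EuclideanSpace ℝ (Fin 3)) u +
          ENNReal.ofReal (a ^ (1 / 2 : ℝ)) * cknE a (0 : ℝ × EuclideanSpace ℝ (Fin 3)) H +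
        ENNReal.ofReal (a ^ (2 * (1 / 2 : ℝ))) * cknD a (0 : ℝ × EuclideanSpace ℝ (Fin 3)) p ≤ (c : ℝ≥0∞))
    {E₀ : ℝ≥0∞} (hE : ∀ᵐ τ : ℝ, τ < 0 → ∫⁻ y, ‖u τ y‖ₑ ^ 2 = E₀)
    {φ : ℝ → EuclideanSpace ℝ (Fin 3) → ℝ}
    (hφ : IsSpaceTimeTestOn (slab (EuclideanSpace ℝ (Fin 3)) (Iio 0) isOpen_Iio) φ)
    (hφ0 : ∀ t x, 0 ≤ φ t x) :
    (∫ t, ∫ x, (‖u t x‖ ^ 2 * timeDeriv φ t x +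
      (‖u t x‖ ^ 2 + 2 * p t x) * ⟪u t x, gradient (φ t) x⟫)) = 0 := by
  have hum : AEStronglyMeasurable (uncurry u)
      (volume.restrict (Iio (0 : ℝ) ×ˢ (univ : Set (EuclideanSpace ℝ (Fin 3))))) := by
    have := hH.locallyIntegrableOn.aestronglyMeasurable
    simpa [slab] using this
  set Q : Opens (ℝ × EuclideanSpace ℝ (Fin 3)) := slab (EuclideanSpace ℝ (Fin 3)) (Iio 0) isOpen_Iio
    with hQ
  -- the energy-flux integrand of a test
  set R : (ℝ → EuclideanSpace ℝ (Fin 3) → ℝ) → ℝ × EuclideanSpace ℝ (Fin 3) → ℝ := fun ψ z =>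
    ‖u z.1 z.2‖ ^ 2 * timeDeriv ψ z.1 z.2 +
      (‖u z.1 z.2‖ ^ 2 + 2 * p z.1 z.2) * ⟪u z.1 z.2, gradient (ψ z.1) z.2⟫ with hR
  rw [(energyFlux_integrable hsw hφ).2]
  change (∫ z, R φ z) = 0
  have hRφ : Integrable (R φ) volume := (energyFlux_integrable hsw hφ).1
  have hpos : 0 ≤ ∫ z, R φ z := localEnergy_nonneg hsw hφ hφ0
  refine le_antisymm ?_ hpos
  -- ## data of the member
  have hA : ∀ a : ℝ, 0 < a → ENNReal.ofReal (a ^ (2 * (1 / 2 : ℝ))) *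
      cknA a (0 : ℝ × EuclideanSpace ℝ (Fin 3)) u ≤ (c : ℝ≥0∞) :=
    fun a ha => le_trans (le_trans le_self_add le_self_add) (hgauge a ha)
  have hfin : ∀ τ : ℝ, τ < 0 → ∫⁻ y, ‖u τ y‖ₑ ^ 2 ≤ c := fun τ hτ =>
    lintegral_enorm_sq_le_of_gauge_half hA hτ
  -- ## data of the test: support box, bound
  set K := tsupport (uncurry φ) with hK
  have hKc : IsCompact K := hφ.hasCompactSupport
  have hKQ : K ⊆ (Q : Set (ℝ × EuclideanSpace ℝ (Fin 3))) := hφ.tsupport_subset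
  obtain ⟨-, -, hgφ0⟩ := hφ.continuous_gradient_field
  have hTφ0 : ∀ z ∉ K, timeDeriv φ z.1 z.2 = 0 := fun z hz =>
    IsSpaceTimeTestOn.timeDeriv_eq_zero_of_notMem hz
  rcases K.eq_empty_or_nonempty with hKe | hKne
  · -- empty support: the integrand vanishes identically
    have h0 : ∀ z, R φ z = 0 := fun z => by
      have hz : z ∉ K := by rw [hKe]; exact notMem_empty _
      show ‖u z.1 z.2‖ ^ 2 * timeDeriv φ z.1 z.2 +
        (‖u z.1 z.2‖ ^ 2 + 2 * p z.1 z.2) * ⟪u z.1 z.2, gradient (φ z.1) z.2⟫ = 0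
      rw [hTφ0 z hz, hgφ0 z hz, inner_zero_right, mul_zero, mul_zero, add_zero]
    rw [integral_congr_ae (Eventually.of_forall h0), integral_zero]
  obtain ⟨zm, hzmK, hzm⟩ := hKc.exists_isMaxOn hKne continuous_fst.continuousOn
  have hb₀ : zm.1 < 0 := by simpa [hQ] using hKQ hzmK
  obtain ⟨R₀, hR₀⟩ := hKc.isBounded.subset_closedBall (0 : ℝ × EuclideanSpace ℝ (Fin 3))
  have hKt : ∀ z ∈ K, -(|R₀| + 1) ≤ z.1 ∧ z.1 ≤ zm.1 := fun z hz => by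
    have h1 : ‖z‖ ≤ R₀ := by simpa using hR₀ hz
    have h2 : |z.1| ≤ R₀ := (norm_fst_le z).trans h1
    exact ⟨by linarith [neg_abs_le z.1, le_abs_self R₀], hzm hz⟩
  have hKx : ∀ z ∈ K, ‖z.2‖ ≤ |R₀| := fun z hz => by
    have h1 : ‖z‖ ≤ R₀ := by simpa using hR₀ hz
    exact ((norm_snd_le z).trans h1).trans (le_abs_self R₀)
  obtain ⟨M, hM⟩ := hφ.contDiff.continuous.bounded_above_of_compact_support hφ.hasCompactSupport
  have hM0 : 0 ≤ M := (norm_nonneg _).trans (hM zm)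
  have hφM : ∀ t x, φ t x ≤ M := fun t x => by
    have := hM (t, x); rw [Real.norm_eq_abs] at this; exact (le_abs_self _).trans this
  -- ## the time cut-off `χ`: `= 1` on `[−|R₀|−1, b₀]`, supported in `t < b₀/2 < 0`
  set b₀ : ℝ := zm.1 with hb₀def
  set c₀ : ℝ := (b₀ - |R₀| - 2) / 2 with hc₀
  have hrIn : 0 < (b₀ + |R₀| + 2) / 2 := by
    have := (hKt zm hzmK).1; linarith
  let χ : ContDiffBump c₀ := ⟨(b₀ + |R₀| + 2) / 2, (b₀ + |R₀| + 2) / 2 + (-b₀) / 2, hrIn, by linarith⟩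
  have hχtop : c₀ + χ.rOut = b₀ / 2 := by
    show (b₀ - |R₀| - 2) / 2 + ((b₀ + |R₀| + 2) / 2 + (-b₀) / 2) = b₀ / 2; ring
  have hχbot : c₀ - χ.rOut = -|R₀| - 2 + b₀ / 2 := by
    show (b₀ - |R₀| - 2) / 2 - ((b₀ + |R₀| + 2) / 2 + (-b₀) / 2) = -|R₀| - 2 + b₀ / 2; ring
  have hχone : ∀ t, -(|R₀| + 1) ≤ t → t ≤ b₀ → (χ : ℝ → ℝ) t = 1 := fun t h1 h2 => by
    refine χ.one_of_mem_closedBall ?_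
    rw [mem_closedBall, Real.dist_eq, abs_le]
    show -((b₀ + |R₀| + 2) / 2) ≤ t - (b₀ - |R₀| - 2) / 2 ∧ t - (b₀ - |R₀| - 2) / 2 ≤ (b₀ + |R₀| + 2) / 2
    constructor <;> linarith
  have hχzero : ∀ t, t ∉ Icc (c₀ - χ.rOut) (c₀ + χ.rOut) → (χ : ℝ → ℝ) t = 0 := fun t ht => by
    refine χ.zero_of_le_dist ?_
    rw [Real.dist_eq]
    rw [mem_Icc, not_and_or, not_le, not_le] at ht
    rcases ht with h | h
    · rw [abs_of_neg (by linarith)]; linarith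
    · rw [abs_of_pos (by linarith)]; linarith
  have hχ01 : ∀ t, 0 ≤ (χ : ℝ → ℝ) t ∧ (χ : ℝ → ℝ) t ≤ 1 := fun t => ⟨χ.nonneg, χ.le_one⟩
  have hχd : ContDiff ℝ (⊤ : ℕ∞) (χ : ℝ → ℝ) := χ.contDiff
  -- `∫ χ' = 0`
  have hχint : ∫ t, deriv (χ : ℝ → ℝ) t = 0 := by
    have hsupp : support (deriv (χ : ℝ → ℝ)) ⊆ Ioc (c₀ - χ.rOut - 1) (c₀ + χ.rOut + 1) := by
      refine (support_deriv_subset (f := (χ : ℝ → ℝ))).trans ?_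
      rw [χ.tsupport_eq]
      intro t ht
      rw [mem_closedBall, Real.dist_eq, abs_le] at ht
      exact ⟨by linarith [ht.1], by linarith [ht.2]⟩
    rw [← intervalIntegral.integral_eq_integral_of_support_subset hsupp,
      intervalIntegral.integral_deriv_eq_sub (fun t _ => (hχd.differentiable (by simp)).differentiableAt)
        ((hχd.continuous_deriv (by simp)).intervalIntegrable _ _)]
    rw [hχzero _ (fun h => by linarith [h.2]), hχzero _ (fun h => by linarith [h.1]), sub_self]
  -- ## the window and its flux integrability
  set αW : ℝ := c₀ - χ.rOut - 1 with hαW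
  set βW : ℝ := b₀ / 4 with hβW
  have hβW0 : βW < 0 := by rw [hβW]; linarith
  have hαβ : αW < βW := by
    rw [hαW, hβW, hχbot]; linarith [abs_nonneg R₀]
  have hwin := windowFlux_integrableOn_of_gauge (ρ := 1 / 2) (by norm_num) hsw hH hgauge hαβ hβW0
  set g : ℝ × EuclideanSpace ℝ (Fin 3) → ℝ :=
    fun z => (‖u z.1 z.2‖ ^ 3 + 2 * |p z.1 z.2| * ‖u z.1 z.2‖) / max 1 ‖z.2‖ with hgdef
  have hg0 : ∀ z, 0 ≤ g z := fun z => by rw [hgdef]; positivity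
  have hfar := tendsto_setIntegral_far_of_integrableOn measurableSet_Ioo hwin
  -- ## the space cut-offs
  obtain ⟨C, hC0, hcut⟩ := cutoffFacts
  set Rk : ℕ → ℝ := fun k => (k : ℝ) + 1 with hRk
  have hRk1 : ∀ k, 1 ≤ Rk k := fun k => by simp only [hRk]; linarith [(k.cast_nonneg : (0 : ℝ) ≤ k)]
  have hRk0 : ∀ k, 0 < Rk k := fun k => lt_of_lt_of_le one_pos (hRk1 k)
  have hσ : ∀ k, ContDiff ℝ (⊤ : ℕ∞) (cutoff (E := EuclideanSpace ℝ (Fin 3)) (Rk k)) :=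
    fun k => (hcut (Rk k) (hRk0 k)).1
  have hσc : ∀ k, HasCompactSupport (cutoff (E := EuclideanSpace ℝ (Fin 3)) (Rk k)) :=
    fun k => (hcut (Rk k) (hRk0 k)).2.1
  have hσ0 : ∀ k x, 0 ≤ cutoff (E := EuclideanSpace ℝ (Fin 3)) (Rk k) x :=
    fun k => (hcut (Rk k) (hRk0 k)).2.2.1
  have hσ1 : ∀ k x, cutoff (E := EuclideanSpace ℝ (Fin 3)) (Rk k) x ≤ 1 :=
    fun k => (hcut (Rk k) (hRk0 k)).2.2.2.1
  have hσone : ∀ k, ∀ x ∈ ball (0 : EuclideanSpace ℝ (Fin 3)) (Rk k), cutoff (Rk k) x = 1 :=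
    fun k => (hcut (Rk k) (hRk0 k)).2.2.2.2.1
  have hσin : ∀ k, ∀ x ∈ ball (0 : EuclideanSpace ℝ (Fin 3)) (Rk k), gradient (cutoff (Rk k)) x = 0 :=
    fun k => (hcut (Rk k) (hRk0 k)).2.2.2.2.2.1
  have hσgrad : ∀ k (x v : EuclideanSpace ℝ (Fin 3)),
      |⟪v, gradient (cutoff (Rk k)) x⟫| ≤ C / Rk k * ‖v‖ := fun k => (hcut (Rk k) (hRk0 k)).2.2.2.2.2.2.2.1
  have hσout : ∀ k (x : EuclideanSpace ℝ (Fin 3)), 2 * Rk k < ‖x‖ → gradient (cutoff (Rk k)) x = 0 :=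
    fun k => (hcut (Rk k) (hRk0 k)).2.2.2.2.2.2.2.2
  -- ## the product tests
  set Φ : ℕ → ℝ → EuclideanSpace ℝ (Fin 3) → ℝ := fun k t x => (χ : ℝ → ℝ) t * cutoff (Rk k) x with hΦ
  have hab : Ioo αW 0 ×ˢ (univ : Set (EuclideanSpace ℝ (Fin 3))) ⊆
      (Q : Set (ℝ × EuclideanSpace ℝ (Fin 3))) := by
    rintro ⟨t, x⟩ ⟨ht, -⟩
    simpa [hQ] using ht.2
  have h₁ : Icc (c₀ - χ.rOut) (c₀ + χ.rOut) ⊆ Ioo αW 0 := fun t ht =>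
    ⟨by rw [hαW]; linarith [ht.1], by rw [hχtop] at ht; linarith [ht.2]⟩
  have hΦtest : ∀ k, IsSpaceTimeTestOn Q (Φ k) := fun k =>
    SuitableRestart.isSpaceTimeTestOn_mul hab hχd h₁ hχzero (hσ k) (hσc k)
  have hΦ0 : ∀ k t x, 0 ≤ Φ k t x := fun k t x => mul_nonneg (hχ01 t).1 (hσ0 k x)
  have hΦT : ∀ k t x, timeDeriv (Φ k) t x = deriv (χ : ℝ → ℝ) t * cutoff (Rk k) x := by
    intro k t x
    show deriv (fun s => (χ : ℝ → ℝ) s * cutoff (Rk k) x) t = _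
    exact deriv_mul_const (hχd.differentiable (by simp)).differentiableAt _
  have hΦg : ∀ k t x, gradient (Φ k t) x = (χ : ℝ → ℝ) t • gradient (cutoff (Rk k)) x := by
    intro k t x
    have hd : DifferentiableAt ℝ (cutoff (E := EuclideanSpace ℝ (Fin 3)) (Rk k)) x :=
      ((hσ k).differentiable (by simp)).differentiableAt
    show gradient (fun x => (χ : ℝ → ℝ) t * cutoff (Rk k) x) x = _
    rw [gradient, gradient, fderiv_const_mul hd, map_smul]
  -- ## the comparison tests `M Φ_k − φ`
  obtain ⟨k₀, hk₀⟩ := exists_nat_gt |R₀|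
  have hΨtest : ∀ k, IsSpaceTimeTestOn Q (fun t x => M * Φ k t x - φ t x) := fun k => by
    have h1 : IsSpaceTimeTestOn Q (fun t x => M * Φ k t x) := by
      have := (hΦtest k).clm_left (M • ContinuousLinearMap.id ℝ ℝ)
      simpa using this
    exact h1.sub hφ
  have hφK0 : ∀ t x, (t, x) ∉ K → φ t x = 0 := fun t x h =>
    show uncurry φ (t, x) = 0 from image_eq_zero_of_notMem_tsupport h
  have hΨ0 : ∀ k, k₀ ≤ k → ∀ t x, 0 ≤ M * Φ k t x - φ t x := by
    intro k hk t x
    by_cases hz : (t, x) ∈ K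
    · have ht := hKt (t, x) hz
      have hx := hKx (t, x) hz
      have h1 : (χ : ℝ → ℝ) t = 1 := hχone t ht.1 ht.2
      have hkR : |R₀| < Rk k := by
        have : (k₀ : ℝ) ≤ k := Nat.cast_le.2 hk
        simp only [hRk]; linarith
      have h2 : cutoff (Rk k) x = 1 :=
        hσone k x (by rw [mem_ball_zero_iff]; exact lt_of_le_of_lt hx hkR)
      have h3 : Φ k t x = 1 := by simp only [hΦ, h1, h2, mul_one]
      rw [h3, mul_one]; linarith [hφM t x]
    · rw [hφK0 t x hz, sub_zero]; exact mul_nonneg hM0 (hΦ0 k t x)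
  -- ## linearity of the functional: `L(M Φ_k − φ) = M L(Φ_k) − L(φ)`, hence `L(φ) ≤ M L(Φ_k)`
  have hRΦ : ∀ k, Integrable (R (Φ k)) volume := fun k => (energyFlux_integrable hsw (hΦtest k)).1
  have hlin : ∀ k, (∫ z, R (fun t x => M * Φ k t x - φ t x) z) =
      M * (∫ z, R (Φ k) z) - ∫ z, R φ z := by
    intro k
    have hpt : ∀ z, R (fun t x => M * Φ k t x - φ t x) z = M * R (Φ k) z - R φ z := by
      intro z
      have hT : timeDeriv (fun t x => M * Φ k t x - φ t x) z.1 z.2 =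
          M * timeDeriv (Φ k) z.1 z.2 - timeDeriv φ z.1 z.2 := by
        rw [timeDeriv_apply]
        exact ((((hΦtest k).hasDerivAt_time z.1 z.2).const_mul M).sub
          (hφ.hasDerivAt_time z.1 z.2)).deriv
      have hd1 : DifferentiableAt ℝ (Φ k z.1) z.2 :=
        (((hΦtest k).contDiff_slice z.1).differentiable (by simp)).differentiableAt
      have hd2 : DifferentiableAt ℝ (φ z.1) z.2 :=
        ((hφ.contDiff_slice z.1).differentiable (by simp)).differentiableAt
      have hG : ⟪u z.1 z.2, gradient (fun x => M * Φ k z.1 x - φ z.1 x) z.2⟫ =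
          M * ⟪u z.1 z.2, gradient (Φ k z.1) z.2⟫ - ⟪u z.1 z.2, gradient (φ z.1) z.2⟫ := by
        rw [EulerReynoldsLadder.inner_gradient_eq_fderiv, EulerReynoldsLadder.inner_gradient_eq_fderiv,
          EulerReynoldsLadder.inner_gradient_eq_fderiv, fderiv_fun_sub (hd1.const_mul M) hd2,
          fderiv_const_mul hd1]
        rfl
      simp only [hR]
      rw [hT, hG]; ring
    rw [integral_congr_ae (Eventually.of_forall hpt), integral_sub ((hRΦ k).const_mul M) hRφ,
      integral_const_mul]
  have hle : ∀ k, k₀ ≤ k → (∫ z, R φ z) ≤ M * ∫ z, R (Φ k) z := by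
    intro k hk
    have h1 : 0 ≤ ∫ z, R (fun t x => M * Φ k t x - φ t x) z :=
      localEnergy_nonneg hsw (hΨtest k) (hΨ0 k hk)
    rw [hlin k] at h1; linarith
  -- ## the functional of the product tests: `L(Φ_k) = ∫ A_k + ∫ B_k`
  set A : ℕ → ℝ × EuclideanSpace ℝ (Fin 3) → ℝ :=
    fun k z => deriv (χ : ℝ → ℝ) z.1 * ‖u z.1 z.2‖ ^ 2 * cutoff (Rk k) z.2 with hAdef
  set B : ℕ → ℝ × EuclideanSpace ℝ (Fin 3) → ℝ := fun k z => (χ : ℝ → ℝ) z.1 *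
    ((‖u z.1 z.2‖ ^ 2 + 2 * p z.1 z.2) * ⟪u z.1 z.2, gradient (cutoff (Rk k)) z.2⟫) with hBdef
  have hRAB : ∀ k z, R (Φ k) z = A k z + B k z := by
    intro k z
    simp only [hR, hAdef, hBdef]
    rw [hΦT k z.1 z.2, hΦg k z.1 z.2, inner_smul_right]
    ring
  -- ## `∫ A_k → E₀ ∫χ' = 0`
  have hθ0' : ∀ t, t ∉ Icc (c₀ - χ.rOut) (c₀ + χ.rOut) → deriv (χ : ℝ → ℝ) t = 0 := by
    intro t ht
    have hts : t ∉ tsupport (χ : ℝ → ℝ) := by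
      rw [χ.tsupport_eq, mem_closedBall, Real.dist_eq, abs_le, not_and_or, not_le, not_le]
      rw [mem_Icc, not_and_or, not_le, not_le] at ht
      rcases ht with h | h
      · exact Or.inl (by linarith)
      · exact Or.inr (by linarith)
    exact notMem_support.1 fun h => hts (support_deriv_subset h)
  have hb₁ : c₀ + χ.rOut < 0 := by rw [hχtop]; linarith
  have hσlim : ∀ x : EuclideanSpace ℝ (Fin 3), ∀ᶠ k in atTop, cutoff (Rk k) x = 1 := by
    intro x
    obtain ⟨N, hN⟩ := exists_nat_gt ‖x‖
    filter_upwards [eventually_ge_atTop N] with k hk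
    refine hσone k x ?_
    rw [mem_ball_zero_iff]
    have : (N : ℝ) ≤ k := Nat.cast_le.2 hk
    simp only [hRk]; linarith
  have hAi : ∀ k, Integrable (A k) volume := fun k =>
    integrable_timecut_energy_mul hum hfin (hχd.continuous_deriv (by simp)) hb₁ hθ0'
      (hσ k).continuous (hσ0 k) (hσ1 k)
  have hAlim : Tendsto (fun k => ∫ z, A k z) atTop (𝓝 0) :=
    tendsto_integral_timecut_energy hum hfin hE (hχd.continuous_deriv (by simp)) hb₁ hθ0' hχint
      (fun k => (hσ k).continuous) hσ0 hσ1 hσlim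
  -- ## `|∫ B_k| ≤ 2C ∫_{window, |x| ≥ k+1} g → 0`
  set Sk : ℕ → Set (ℝ × EuclideanSpace ℝ (Fin 3)) :=
    fun k => Ioo αW βW ×ˢ {x : EuclideanSpace ℝ (Fin 3) | (k : ℝ) + 1 ≤ ‖x‖} with hSk
  have hSkm : ∀ k, MeasurableSet (Sk k) := fun k =>
    measurableSet_Ioo.prod (measurableSet_le measurable_const measurable_norm)
  have hBbound : ∀ k z, ‖B k z‖ ≤ 2 * C * (Sk k).indicator g z := by
    intro k z
    have hrhs0 : 0 ≤ 2 * C * (Sk k).indicator g z :=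
      mul_nonneg (by positivity) (indicator_nonneg (fun z _ => hg0 z) z)
    by_cases hχz : (χ : ℝ → ℝ) z.1 = 0
    · simp only [hBdef, hχz, zero_mul, norm_zero]; exact hrhs0
    by_cases hgr : gradient (cutoff (Rk k)) z.2 = 0
    · simp only [hBdef, hgr, inner_zero_right, mul_zero, norm_zero]; exact hrhs0
    -- `z` lies in `Sk k`, with `Rk k ≤ ‖z.2‖ ≤ 2 Rk k`
    have hzt : z.1 ∈ Icc (c₀ - χ.rOut) (c₀ + χ.rOut) := by
      by_contra h; exact hχz (hχzero z.1 h)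
    have hx1 : Rk k ≤ ‖z.2‖ := by
      by_contra h; exact hgr (hσin k z.2 (by rw [mem_ball_zero_iff]; linarith))
    have hx2 : ‖z.2‖ ≤ 2 * Rk k := by
      by_contra h; exact hgr (hσout k z.2 (by linarith))
    have hzS : z ∈ Sk k := by
      refine ⟨⟨by rw [hαW]; linarith [hzt.1], ?_⟩, by simpa [hRk] using hx1⟩
      rw [hβW]; rw [hχtop] at hzt; linarith [hzt.2]
    rw [indicator_of_mem hzS]
    have hmax : max 1 ‖z.2‖ ≤ 2 * Rk k := max_le (by linarith [hRk1 k]) hx2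
    have hmax0 : 0 < max 1 ‖z.2‖ := lt_of_lt_of_le one_pos (le_max_left _ _)
    have hCR : C / Rk k ≤ 2 * C / max 1 ‖z.2‖ := by
      rw [← mul_div_mul_left C (Rk k) (two_ne_zero : (2 : ℝ) ≠ 0)]
      exact div_le_div_of_nonneg_left (by positivity) hmax0 hmax
    have hin : |⟪u z.1 z.2, gradient (cutoff (Rk k)) z.2⟫| ≤ C / Rk k * ‖u z.1 z.2‖ :=
      hσgrad k z.2 (u z.1 z.2)
    have hχabs : |(χ : ℝ → ℝ) z.1| ≤ 1 := by
      rw [abs_of_nonneg (hχ01 z.1).1]; exact (hχ01 z.1).2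
    have habs : |‖u z.1 z.2‖ ^ 2 + 2 * p z.1 z.2| ≤ ‖u z.1 z.2‖ ^ 2 + 2 * |p z.1 z.2| :=
      calc |‖u z.1 z.2‖ ^ 2 + 2 * p z.1 z.2| ≤ |‖u z.1 z.2‖ ^ 2| + |2 * p z.1 z.2| := abs_add_le _ _
        _ = ‖u z.1 z.2‖ ^ 2 + 2 * |p z.1 z.2| := by
          rw [abs_of_nonneg (by positivity : (0 : ℝ) ≤ ‖u z.1 z.2‖ ^ 2), abs_mul, abs_two]
    calc ‖B k z‖ = |(χ : ℝ → ℝ) z.1| *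
          (|‖u z.1 z.2‖ ^ 2 + 2 * p z.1 z.2| * |⟪u z.1 z.2, gradient (cutoff (Rk k)) z.2⟫|) := by
          simp only [hBdef, Real.norm_eq_abs, abs_mul]
      _ ≤ 1 * ((‖u z.1 z.2‖ ^ 2 + 2 * |p z.1 z.2|) * (C / Rk k * ‖u z.1 z.2‖)) :=
          mul_le_mul hχabs (mul_le_mul habs hin (abs_nonneg _) (by positivity)) (by positivity)
            zero_le_one
      _ = C / Rk k * (‖u z.1 z.2‖ ^ 3 + 2 * |p z.1 z.2| * ‖u z.1 z.2‖) := by ring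
      _ ≤ 2 * C / max 1 ‖z.2‖ * (‖u z.1 z.2‖ ^ 3 + 2 * |p z.1 z.2| * ‖u z.1 z.2‖) :=
          mul_le_mul_of_nonneg_right hCR (by positivity)
      _ = 2 * C * g z := by simp only [hgdef]; ring
  have hgi : ∀ k, Integrable ((Sk k).indicator g) volume := fun k =>
    (hwin.mono_set (prod_mono subset_rfl (subset_univ _))).integrable_indicator (hSkm k)
  have hBi : ∀ k, Integrable (B k) volume := fun k =>
    ((hRΦ k).sub (hAi k)).congr (Eventually.of_forall fun z => by
      show R (Φ k) z - A k z = B k z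
      rw [hRAB k z]; ring)
  have hBle : ∀ k, ‖∫ z, B k z‖ ≤ 2 * C * ∫ z in Sk k, g z := fun k => by
    have := norm_integral_le_of_norm_le ((hgi k).const_mul (2 * C))
      (Eventually.of_forall (hBbound k))
    rwa [integral_const_mul, integral_indicator (hSkm k)] at this
  have hBlim : Tendsto (fun k => ∫ z, B k z) atTop (𝓝 0) := by
    refine squeeze_zero_norm hBle ?_
    have := hfar.const_mul (2 * C)
    rw [mul_zero] at this; simpa only [hSk] using this
  -- ## conclusion: `L(φ) ≤ M L(Φ_k) = M (∫A_k + ∫B_k) → 0`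
  have hT : Tendsto (fun k => M * ∫ z, R (Φ k) z) atTop (𝓝 0) := by
    have h := (hAlim.add hBlim).const_mul M
    rw [add_zero, mul_zero] at h
    refine h.congr' (Eventually.of_forall fun k => ?_)
    show M * ((∫ z, A k z) + ∫ z, B k z) = M * ∫ z, R (Φ k) z
    rw [← integral_add (hAi k) (hBi k)]
    congr 1
    exact integral_congr_ae (Eventually.of_forall fun z => (hRAB k z).symm)
  exact ge_of_tendsto hT (eventually_atTop.2 ⟨k₀, fun k hk => hle k hk⟩)

/-- **Every DISCRETELY self-similar member at `ρ = 1/2` satisfies the local energy EQUALITY.**  For a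
member `(u, p, H, c)` of the crux class at the energy-conserving endpoint which is discretely
self-similar with a factor `l > 1` (`u(τ, y) = l^{3/2} u(l^{5/2}τ, l y)` for `τ < 0`), the class
functional vanishes on every nonnegative test: `∫∫ (|u|² ∂_tφ + (|u|²+2p)⟪u,∇φ⟫) = 0` — the total
energy is a.e. constant (`dss_half_energy_ae_const`) and `localEnergyEquality_of_energy_ae_const_half`
applies.  (The DSS analogue of the lead's `selfSimilar_endpoint_flux_identity`.) [folklore] -/
theorem dss_half_localEnergyEquality
    (hsw : IsSuitableWeakSolutionOn (slab (EuclideanSpace ℝ (Fin 3)) (Iio 0) isOpen_Iio) 0 0 u p)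
    (hH : HasWeakSpatialGradientOn (slab (EuclideanSpace ℝ (Fin 3)) (Iio 0) isOpen_Iio) u H)
    (hgauge : ∀ a : ℝ, 0 < a →
      ENNReal.ofReal (a ^ (2 * (1 / 2 : ℝ))) * cknA a (0 : ℝ × EuclideanSpace ℝ (Fin 3)) u +
          ENNReal.ofReal (a ^ (1 / 2 : ℝ)) * cknE a (0 : ℝ × EuclideanSpace ℝ (Fin 3)) H +
        ENNReal.ofReal (a ^ (2 * (1 / 2 : ℝ))) * cknD a (0 : ℝ × EuclideanSpace ℝ (Fin 3)) p ≤ (c : ℝ≥0∞))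
    {l : ℝ} (hl : 1 < l)
    (hu : ∀ τ : ℝ, τ < 0 → ∀ y, u τ y = (l ^ (3 / 2 : ℝ)) • u (l ^ (5 / 2 : ℝ) * τ) (l • y))
    {φ : ℝ → EuclideanSpace ℝ (Fin 3) → ℝ}
    (hφ : IsSpaceTimeTestOn (slab (EuclideanSpace ℝ (Fin 3)) (Iio 0) isOpen_Iio) φ)
    (hφ0 : ∀ t x, 0 ≤ φ t x) :
    (∫ t, ∫ x, (‖u t x‖ ^ 2 * timeDeriv φ t x +
      (‖u t x‖ ^ 2 + 2 * p t x) * ⟪u t x, gradient (φ t) x⟫)) = 0 := by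
  obtain ⟨E₀, -, hE⟩ := dss_half_energy_ae_const hsw hH hgauge hl hu
  exact localEnergyEquality_of_energy_ae_const_half hsw hH hgauge hE hφ hφ0

end Equality

end Summit.NavierStokesRegularity.NavierStokesRegularity.Theorems.PowerGaugeEulerLiouville
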